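import Summits.AtomisticToContinuum.HydrodynamicLimit.Theorems.AntiMazurCoboundariesKineticWindowGronwallDensityOnlyWindowRenyi
import Summits.AtomisticToContinuum.HydrodynamicLimit.Theorems.AntiMazurCoboundariesKineticWindowGronwallWindowRenyiOfIncrementTightnessPrelim
import Mathlib.Analysis.MeanInequalities
import HarnessLib

/-!
# Rényi quasi-invariance of local Gibbs laws from increment tightness
# (stub `stub_windowRenyiOfIncrementTightness`, line `board-node-dock`, crux `KineticWindowGronwall`, stmt-AtomisticToContinuum-9282)

Crux `Summit.AtomisticToContinuum.HydrodynamicLimit.Theses.AntiMazurCoboundaries.KineticWindowGronwall`. The load-bearing stub of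
the line is the LOCAL kinetic node (window LD bounds under the local Gibbs laws `λ_N = ψ_N · L`, `L` the flow-invariant Liouville
measure, `ψ_N` NOT invariant). Its content (iii) — moving windows in time under the non-invariant reference — is paid by the
order-`p` Rényi integral (R) `∫ (ψ_N(Φ_{-s} z)/ψ_N(z))^p dλ_N ≤ e^{ε(N+1)}` over kinetic windows `0 ≤ s ≤ τ(N+1)^{-1/3}`
(companions `…RenyiHolderTransfer`, `…WindowClauseOfRenyi`; density-only data `…DensityOnlyWindowRenyi`). THIS FILE proves (R) for
GENERAL continuous data `(a, θ₀, u₀)`, `a, θ₀ > 0`, GIVEN the two increment-tightness hypotheses of the registered statement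
`WindowRenyiOfIncrementTightness`: exponential moments `≤ e^{ε(N+1)}` at parameter `3(p−1)` of the window increments of the
`θ₀⁻¹`-weighted kinetic energy `energyObservable θ₀⁻¹` and of the `u₀/θ₀`-tested momentum `momentumObservable (θ₀⁻¹ • u₀)`.

PROOF (the companion `…WindowRenyiOfIncrementTightnessPrelim` supplies the forward form and the statics). The one-body
profile is `a(x) M_{1,u₀(x),θ₀(x)}(v) = exp(ℓ(x) − θ₀(x)⁻¹‖v‖²/2 + ⟪θ₀(x)⁻¹u₀(x), v⟫)` with the POSITION-ONLY continuous
`ℓ = log(a (2πθ₀)^{-3/2}) − ‖u₀‖²/(2θ₀)`, so on the hard-sphere domain `ψ_N = Z⁻¹ exp S` with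
`S(z) = Σᵢ ℓ(xᵢ) − energyObservable θ₀⁻¹ z + momentumObservable (θ₀⁻¹•u₀) z`. If `Z = 0` the law vanishes. If `Z > 0`,
Liouville invariance (`HardSphereFlow.measurePreserving`, `flow_neg_flow` on the conull good set) turns the Rényi integral into
the FORWARD expectation `∫ exp((p−1)(S(w) − S(Φ_s w))) λ_N(dw)`; `S(w) − S(Φ_s w) = −Δℓ + ΔE − ΔM ≤ |Δℓ| + |ΔE| + |ΔM|` and
AM–GM `exp(t(x+y+z)) ≤ (e^{3tx} + e^{3ty} + e^{3tz})/3` split the integrand into the two hypotheses and the position factor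
`∫ exp(3(p−1)|Δℓ|) dλ_N`, which is `≤ e^{ε(N+1)}` eventually exactly as in the density-only file: `|ℓ(x) − ℓ(y)| ≤ δ + K dist`
(uniform continuity on `𝕋³`), total displacement `≤ s((N+1)/2 + E)` (path length against the conserved energy), and the
Gaussian-fibre bound `∫ e^{cE} dλ_N ≤ e^{(1 + 2U² + 12θM)(c/2)(N+1)}` for `c ≤ 1/(4θM)` (with `x`-dependent temperature
`θ₀ ≤ θM` and drift `‖u₀‖ ≤ U`), `s ≤ τ(N+1)^{-1/3} → 0`. Folklore (local equilibrium states, Spohn 1991 Part I §2.3;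
Liouville theorem for hard spheres, GST 2013 Prop. 4.1.1). No Theses declaration is concluded; no named fact is used.
-/

noncomputable section

namespace Summit.AtomisticToContinuum.HydrodynamicLimit.Theorems.KineticWindowGronwallWindowRenyiOfIncrementTightness

open _root_.MeasureTheory _root_.Set _root_.Filter
open scoped _root_.ENNReal
open Literature.Analysis.FluidPDE Literature.MathematicalPhysics.KineticTheory

/-! ## §1 Statements (verbatim from the line's toolkit `Cruxes/KineticWindowGronwall/Lines/board_node_dock_toolkit.lean`) -/

/-- The hard-sphere flow of `N+1` spheres at reduced density `σ` on `𝕋³`. -/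
abbrev TFlow (σ : ℝ) (N : ℕ) : Type :=
  HardSphereFlow (Torus.geometry (Fin 3)) (hsDiameter σ N) (N + 1)

/-- The Liouville measure of `N+1` spheres at reduced density `σ` on `𝕋³`. -/
abbrev liou (σ : ℝ) (N : ℕ) : Measure (Config (N + 1) (Fin 3) T3) :=
  liouville (Torus.geometry (Fin 3)) (N + 1) (hsDiameter σ N)

/-- The local Gibbs DENSITY with respect to the Liouville measure (the canonical density of the local Gibbs profile,
as an extended nonnegative real): `localGibbsLaw σ a u₀ θ₀ N Φ = (liou σ N).withDensity (lgDensity σ a θ₀ u₀ N)`. -/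
def lgDensity (σ : ℝ) (a θ₀ : T3 → ℝ) (u₀ : T3 → V3) (N : ℕ) (z : Config (N + 1) (Fin 3) T3) : ℝ≥0∞ :=
  ENNReal.ofReal (canonicalDensity (Torus.geometry (Fin 3)) (hsDiameter σ N) (N + 1) (localGibbsProfile a u₀ θ₀) z)

/-- **Helper statement `WindowRenyiOfIncrementTightness`** (GENERAL data; the open dynamic input of content (iii) made explicit):
for continuous data `(a, θ₀, u₀)` with `a, θ₀ > 0`, a flow family and an order `p > 1`, IF the kinetic-window INCREMENTS of the
`θ₀⁻¹`-weighted kinetic energy `Σᵢ ‖vᵢ‖²/(2θ₀(xᵢ))` (`energyObservable θ₀⁻¹`) and of the `u₀/θ₀`-tested momentum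
`Σᵢ ⟨u₀(xᵢ)/θ₀(xᵢ), vᵢ⟩` (`momentumObservable (θ₀⁻¹ • u₀)`) along the flow have exponential moments `≤ e^{ε(N+1)}` at parameter
`3(p−1)`, eventually in `N`, uniformly over shifts `0 ≤ s ≤ τ(N+1)^{-1/3}`, THEN the order-`p` Rényi quasi-invariance (R) of the local
Gibbs laws holds in exactly the form consumed by `WindowClauseOfRenyi` (the activity / log-partition part moves by the path length, as in
`DensityOnlyWindowRenyi`; Liouville invariance turns the Rényi integral into the forward expectation `E_λ[(ψ/ψ∘Φ_s)^{p−1}]`; Hölder). -/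
def WindowRenyiOfIncrementTightness : Prop :=
  ∀ (σ : ℝ) (a θ₀ : T3 → ℝ) (u₀ : T3 → V3), Continuous a → Continuous θ₀ → Continuous u₀ →
    (∀ x, 0 < a x) → (∀ x, 0 < θ₀ x) →
    ∀ (Φ : (N : ℕ) → TFlow σ N) (p : ℝ), 1 < p →
    (∀ τ ε : ℝ, 0 < τ → 0 < ε → ∃ N₀ : ℕ, ∀ N : ℕ, N₀ ≤ N → ∀ s : ℝ, 0 ≤ s →
        s ≤ τ * ((N : ℝ) + 1) ^ (-(1 / 3 : ℝ)) →
        ∫⁻ z, ENNReal.ofReal (Real.exp (3 * (p - 1) *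
            |energyObservable (fun x => (θ₀ x)⁻¹) ((Φ N).flow s z) - energyObservable (fun x => (θ₀ x)⁻¹) z|))
          ∂(localGibbsLaw σ a u₀ θ₀ N (Φ N)) ≤ ENNReal.ofReal (Real.exp (ε * ((N : ℝ) + 1)))) →
    (∀ τ ε : ℝ, 0 < τ → 0 < ε → ∃ N₀ : ℕ, ∀ N : ℕ, N₀ ≤ N → ∀ s : ℝ, 0 ≤ s →
        s ≤ τ * ((N : ℝ) + 1) ^ (-(1 / 3 : ℝ)) →
        ∫⁻ z, ENNReal.ofReal (Real.exp (3 * (p - 1) *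
            |momentumObservable (fun x => (θ₀ x)⁻¹ • u₀ x) ((Φ N).flow s z) -
              momentumObservable (fun x => (θ₀ x)⁻¹ • u₀ x) z|))
          ∂(localGibbsLaw σ a u₀ θ₀ N (Φ N)) ≤ ENNReal.ofReal (Real.exp (ε * ((N : ℝ) + 1)))) →
    ∀ τ ε : ℝ, 0 < τ → 0 < ε → ∃ N₀ : ℕ, ∀ N : ℕ, N₀ ≤ N → ∀ s : ℝ, 0 ≤ s →
        s ≤ τ * ((N : ℝ) + 1) ^ (-(1 / 3 : ℝ)) →
        ∫⁻ z, (lgDensity σ a θ₀ u₀ N ((Φ N).flow (-s) z) / lgDensity σ a θ₀ u₀ N z) ^ p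
            ∂(localGibbsLaw σ a u₀ θ₀ N (Φ N)) ≤ ENNReal.ofReal (Real.exp (ε * ((N : ℝ) + 1)))


/-! ## §2 AM–GM and the position factor -/

open KineticWindowGronwallWindowRenyiOfIncrementTightnessPrelim (ell logW continuous_ell lintegral_renyi_eq_forward
  lintegral_exp_mul_configEnergy_le)

/-- AM–GM for three exponentials, in `ℝ≥0∞`: `exp(t(x + y + z)) ≤ e^{3tx}/3 + e^{3ty}/3 + e^{3tz}/3`. [folklore] -/
theorem ofReal_exp_mul_add_add_le (t x y z : ℝ) :
    ENNReal.ofReal (Real.exp (t * (x + y + z))) ≤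
      ENNReal.ofReal (Real.exp (3 * t * x)) / 3 + ENNReal.ofReal (Real.exp (3 * t * y)) / 3 +
        ENNReal.ofReal (Real.exp (3 * t * z)) / 3 := by
  have h := Real.geom_mean_le_arith_mean3_weighted (w₁ := 1 / 3) (w₂ := 1 / 3) (w₃ := 1 / 3)
    (p₁ := Real.exp (3 * t * x)) (p₂ := Real.exp (3 * t * y)) (p₃ := Real.exp (3 * t * z)) (by norm_num)
    (by norm_num) (by norm_num) (Real.exp_pos _).le (Real.exp_pos _).le (Real.exp_pos _).le (by norm_num)
  have e : ∀ r : ℝ, Real.exp (3 * t * r) ^ (1 / 3 : ℝ) = Real.exp (t * r) := fun r => by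
    rw [← Real.exp_mul]; congr 1; ring
  rw [e, e, e, ← Real.exp_add, ← Real.exp_add] at h
  have h' : Real.exp (t * (x + y + z)) ≤
      Real.exp (3 * t * x) / 3 + Real.exp (3 * t * y) / 3 + Real.exp (3 * t * z) / 3 := by
    rw [show t * (x + y + z) = t * x + t * y + t * z by ring]
    linarith
  refine (ENNReal.ofReal_le_ofReal h').trans_eq ?_
  rw [ENNReal.ofReal_add (by positivity) (by positivity), ENNReal.ofReal_add (by positivity) (by positivity),
    ENNReal.ofReal_div_of_pos zero_lt_three, ENNReal.ofReal_div_of_pos zero_lt_three,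
    ENNReal.ofReal_div_of_pos zero_lt_three, ENNReal.ofReal_ofNat]


/-- **The position factor over a kinetic window.** For continuous data with `a, θ₀ > 0`, a flow family, `q > 0`, `τ`, `ε > 0`:
eventually in `N`, for all `0 ≤ s ≤ τ(N+1)^{-1/3}`, `∫ exp(q |Σᵢ ℓ(xᵢ(s)) − Σᵢ ℓ(xᵢ(0))|) dλ_N ≤ e^{ε(N+1)}` — affine modulus
`|ℓ x − ℓ y| ≤ δ + K dist` (`exists_affine_modulus`), displacement `Σᵢ dist ≤ s((N+1)/2 + E)` (`sum_euclidDist_flow_neg_le`),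
Gaussian-fibre energy moment (`lintegral_exp_mul_configEnergy_le`), and `τ(N+1)^{-1/3} → 0`. [folklore] -/
theorem lintegral_exp_ell_increment_le {a θ₀ : T3 → ℝ} {u₀ : T3 → V3} (ha : Continuous a) (hθ : Continuous θ₀)
    (hu : Continuous u₀) (ha0 : ∀ x, 0 < a x) (hθ0 : ∀ x, 0 < θ₀ x) (σ : ℝ) (Φ : (N : ℕ) → TFlow σ N) {q : ℝ}
    (hq : 0 < q) (τ : ℝ) {ε : ℝ} (hε : 0 < ε) :
    ∃ N₀ : ℕ, ∀ N : ℕ, N₀ ≤ N → ∀ s : ℝ, 0 ≤ s → s ≤ τ * ((N : ℝ) + 1) ^ (-(1 / 3 : ℝ)) →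
      ∫⁻ z, ENNReal.ofReal (Real.exp (q *
          |∑ i, ell a θ₀ u₀ ((Φ N).flow s z i).1 - ∑ i, ell a θ₀ u₀ (z i).1|)) ∂(localGibbsLaw σ a u₀ θ₀ N (Φ N)) ≤
        ENNReal.ofReal (Real.exp (ε * ((N : ℝ) + 1))) := by
  -- bounds of the continuous profiles on the compact torus
  obtain ⟨θM, -, hθM⟩ := exists_forall_abs_le_of_continuous hθ
  obtain ⟨U, -, hU⟩ := exists_forall_abs_le_of_continuous hu.norm
  have hθM' : ∀ x, θ₀ x ≤ θM := fun x => (le_abs_self _).trans (hθM x)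
  have hU' : ∀ x, ‖u₀ x‖ ≤ U := fun x => (le_abs_self _).trans (hU x)
  have hθMpos : 0 < θM := (hθ0 0).trans_le (hθM' 0)
  -- the affine modulus of `ℓ` at precision `δ = ε/(2q)`
  obtain ⟨K, hK0, hK⟩ := KineticWindowGronwallDensityOnlyWindowRenyi.exists_affine_modulus
    (continuous_ell ha hθ hu ha0 hθ0) (δ := ε / (2 * q)) (by positivity)
  set C : ℝ := 1 + 2 * U ^ 2 + 12 * θM with hC
  have hC0 : 0 < C := by positivity
  set h₀ : ℝ := min (1 / (4 * θM * (q * K + 1))) (ε / ((q * K + 1) * (1 + C))) with hh₀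
  have hh₀pos : 0 < h₀ := lt_min (by positivity) (by positivity)
  -- the window length `τ (N+1)^{-1/3}` tends to `0`
  have hwin : Tendsto (fun N : ℕ => τ * ((N : ℝ) + 1) ^ (-(1 / 3 : ℝ))) atTop (nhds 0) := by
    simpa using ((tendsto_rpow_neg_atTop (by norm_num : (0 : ℝ) < 1 / 3)).comp
      (tendsto_atTop_add_const_right _ 1 tendsto_natCast_atTop_atTop)).const_mul τ
  obtain ⟨N₀, hN₀⟩ := eventually_atTop.1 (hwin.eventually (Iic_mem_nhds hh₀pos))
  refine ⟨N₀, fun N hN s hs0 hs => ?_⟩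
  have hsN : s ≤ h₀ := hs.trans (hN₀ N hN)
  have hs1 : s ≤ 1 / (4 * θM * (q * K + 1)) := hsN.trans (min_le_left _ _)
  have hs2 : s ≤ ε / ((q * K + 1) * (1 + C)) := hsN.trans (min_le_right _ _)
  -- the tilt of the energy moment `c = q K s ≤ 1/(4θM)`
  set c : ℝ := q * K * s with hc
  have hc0 : 0 ≤ c := by positivity
  have hqK : q * K ≤ q * K + 1 := by linarith
  have hcle : c ≤ (q * K + 1) * s := by rw [hc]; exact mul_le_mul_of_nonneg_right hqK hs0
  have hc1 : c ≤ 1 / (4 * θM) := by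
    calc c ≤ (q * K + 1) * s := hcle
      _ ≤ (q * K + 1) * (1 / (4 * θM * (q * K + 1))) := mul_le_mul_of_nonneg_left hs1 (by positivity)
      _ = 1 / (4 * θM) := by field_simp
  have hc2 : c * (1 + C) ≤ ε := by
    calc c * (1 + C) ≤ (q * K + 1) * s * (1 + C) := mul_le_mul_of_nonneg_right hcle (by positivity)
      _ ≤ (q * K + 1) * (ε / ((q * K + 1) * (1 + C))) * (1 + C) :=
          mul_le_mul_of_nonneg_right (mul_le_mul_of_nonneg_left hs2 (by positivity)) (by positivity)
      _ = ε := by field_simp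
  set P := localGibbsLaw σ a u₀ θ₀ N (Φ N) with hP
  set A : ℝ := q * (((N : ℝ) + 1) * (ε / (2 * q)) + K * (s * (((N : ℝ) + 1) / 2))) with hA
  -- a.e. pointwise bound on good orbits
  have hpt : ∀ᵐ z ∂P, ENNReal.ofReal (Real.exp (q *
      |∑ i, ell a θ₀ u₀ ((Φ N).flow s z i).1 - ∑ i, ell a θ₀ u₀ (z i).1|)) ≤
      ENNReal.ofReal (Real.exp A) * ENNReal.ofReal (Real.exp (c * configEnergy z)) := by
    filter_upwards [KineticWindowGronwallQuadraticMoment.ae_mem_good_localGibbsLaw σ a u₀ θ₀ N (Φ N)] with z hz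
    rw [← ENNReal.ofReal_mul (Real.exp_pos _).le, ← Real.exp_add]
    refine ENNReal.ofReal_le_ofReal (Real.exp_le_exp.2 ?_)
    have hdisp : ∑ i, Torus.euclidDist (((Φ N).flow s z i).1) ((z i).1) ≤
        s * (((N : ℝ) + 1) / 2 + configEnergy z) := by
      have h := KineticWindowGronwallDensityOnlyWindowRenyi.sum_euclidDist_flow_neg_le (Φ N) hz (-s)
      rwa [neg_neg, abs_neg, abs_of_nonneg hs0] at h
    have hsum : |∑ i, ell a θ₀ u₀ ((Φ N).flow s z i).1 - ∑ i, ell a θ₀ u₀ (z i).1| ≤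
        ((N : ℝ) + 1) * (ε / (2 * q)) + K * (s * (((N : ℝ) + 1) / 2 + configEnergy z)) := by
      rw [← Finset.sum_sub_distrib]
      refine (Finset.abs_sum_le_sum_abs _ _).trans ?_
      calc ∑ i, |ell a θ₀ u₀ ((Φ N).flow s z i).1 - ell a θ₀ u₀ (z i).1|
          ≤ ∑ i, (ε / (2 * q) + K * Torus.euclidDist (((Φ N).flow s z i).1) ((z i).1)) :=
            Finset.sum_le_sum fun i _ => hK _ _
        _ = ((N : ℝ) + 1) * (ε / (2 * q)) + K * ∑ i, Torus.euclidDist (((Φ N).flow s z i).1) ((z i).1) := by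
            rw [Finset.sum_add_distrib, Finset.sum_const, Finset.card_univ, Fintype.card_fin, nsmul_eq_mul,
              ← Finset.mul_sum]
            push_cast
            ring
        _ ≤ ((N : ℝ) + 1) * (ε / (2 * q)) + K * (s * (((N : ℝ) + 1) / 2 + configEnergy z)) := by gcongr
    calc q * |∑ i, ell a θ₀ u₀ ((Φ N).flow s z i).1 - ∑ i, ell a θ₀ u₀ (z i).1|
        ≤ q * (((N : ℝ) + 1) * (ε / (2 * q)) + K * (s * (((N : ℝ) + 1) / 2 + configEnergy z))) :=
          mul_le_mul_of_nonneg_left hsum hq.le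
      _ = A + c * configEnergy z := by rw [hA, hc]; ring
  calc ∫⁻ z, ENNReal.ofReal (Real.exp (q *
          |∑ i, ell a θ₀ u₀ ((Φ N).flow s z i).1 - ∑ i, ell a θ₀ u₀ (z i).1|)) ∂P
      ≤ ∫⁻ z, ENNReal.ofReal (Real.exp A) * ENNReal.ofReal (Real.exp (c * configEnergy z)) ∂P :=
        lintegral_mono_ae hpt
    _ = ENNReal.ofReal (Real.exp A) * ∫⁻ z, ENNReal.ofReal (Real.exp (c * configEnergy z)) ∂P :=
        lintegral_const_mul' _ _ ENNReal.ofReal_ne_top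
    _ ≤ ENNReal.ofReal (Real.exp A) *
          ENNReal.ofReal (Real.exp ((1 + 2 * U ^ 2 + 12 * θM) * (c / 2) * ((N : ℝ) + 1))) :=
        mul_le_mul' le_rfl (lintegral_exp_mul_configEnergy_le ha hθ hu ha0 hθ0 hθM' hU' σ N (Φ N) hc0 hc1)
    _ = ENNReal.ofReal (Real.exp (((N : ℝ) + 1) * (ε / 2 + c / 2 + C * (c / 2)))) := by
        rw [← ENNReal.ofReal_mul (Real.exp_pos _).le, ← Real.exp_add, hC, hc, hA]
        congr 2
        field_simp
    _ ≤ ENNReal.ofReal (Real.exp (ε * ((N : ℝ) + 1))) := by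
        refine ENNReal.ofReal_le_ofReal (Real.exp_le_exp.2 ?_)
        have hN1 : (0 : ℝ) ≤ (N : ℝ) + 1 := by positivity
        have key : ε / 2 + c / 2 + C * (c / 2) ≤ ε := by nlinarith
        nlinarith

/-! ## §3 Assembly: the registered stub -/

/-- **`stub_windowRenyiOfIncrementTightness`: the registered statement `WindowRenyiOfIncrementTightness` holds** —
`Z = 0`: the law vanishes; `Z > 0`: forward form (`lintegral_renyi_eq_forward`), `S(w) − S(Φ_s w) ≤ |Δℓ| + |ΔE| + |ΔM|`,
AM–GM, the two increment-tightness hypotheses and the position factor, each at precision `ε`. [folklore] -/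
theorem stub_windowRenyiOfIncrementTightness : WindowRenyiOfIncrementTightness := by
  intro σ a θ₀ u₀ ha hθ hu ha0 hθ0 Φ p hp hE hM τ ε hτ hε
  have hp1 : 0 < p - 1 := sub_pos.2 hp
  obtain ⟨N₁, hN₁⟩ := hE τ ε hτ hε
  obtain ⟨N₂, hN₂⟩ := hM τ ε hτ hε
  obtain ⟨N₃, hN₃⟩ := lintegral_exp_ell_increment_le ha hθ hu ha0 hθ0 σ Φ (q := 3 * (p - 1)) (by positivity) τ hε
  refine ⟨max N₁ (max N₂ N₃), fun N hN s hs0 hs => ?_⟩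
  have h1 := hN₁ N (le_of_max_le_left hN) s hs0 hs
  have h2 := hN₂ N (le_of_max_le_left (le_of_max_le_right hN)) s hs0 hs
  have h3 := hN₃ N (le_of_max_le_right (le_of_max_le_right hN)) s hs0 hs
  -- the degenerate case `Z = 0`: the law is the zero measure
  rcases (Literature.MathematicalPhysics.KineticTheory.canonicalPartition_nonneg (Torus.geometry (Fin 3))
    (hsDiameter σ N) (N + 1) (f := localGibbsProfile a u₀ θ₀)
    (localGibbsProfile_nonneg (fun x => (ha0 x).le) fun x => (hθ0 x).le)).eq_or_lt with hZ | hZ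
  · have hψ : lgDensity σ a θ₀ u₀ N = 0 := by
      funext z
      simp [lgDensity, canonicalDensity, ← hZ]
    have hlaw : localGibbsLaw σ a u₀ θ₀ N (Φ N) = 0 := by
      change (liou σ N).withDensity (lgDensity σ a θ₀ u₀ N) = 0
      rw [hψ, withDensity_zero]
    rw [hlaw, lintegral_zero_measure]
    exact zero_le
  -- `Z > 0`: forward form
  have key : ∫⁻ z, (lgDensity σ a θ₀ u₀ N ((Φ N).flow (-s) z) / lgDensity σ a θ₀ u₀ N z) ^ p
        ∂(localGibbsLaw σ a u₀ θ₀ N (Φ N)) =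
      ∫⁻ w, ENNReal.ofReal (Real.exp ((p - 1) * (logW a θ₀ u₀ w - logW a θ₀ u₀ ((Φ N).flow s w))))
        ∂(localGibbsLaw σ a u₀ θ₀ N (Φ N)) :=
    lintegral_renyi_eq_forward (Φ N) ha hθ hu ha0 hθ0 hZ s p
  rw [key]
  set P := localGibbsLaw σ a u₀ θ₀ N (Φ N) with hP
  set E₁ : ℝ≥0∞ := ENNReal.ofReal (Real.exp (ε * ((N : ℝ) + 1))) with hE₁
  -- the three increment functionals
  set FL : Config (N + 1) (Fin 3) T3 → ℝ≥0∞ := fun w => ENNReal.ofReal (Real.exp (3 * (p - 1) *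
    |∑ i, ell a θ₀ u₀ ((Φ N).flow s w i).1 - ∑ i, ell a θ₀ u₀ (w i).1|)) with hFL
  set FE : Config (N + 1) (Fin 3) T3 → ℝ≥0∞ := fun w => ENNReal.ofReal (Real.exp (3 * (p - 1) *
    |energyObservable (fun x => (θ₀ x)⁻¹) ((Φ N).flow s w) - energyObservable (fun x => (θ₀ x)⁻¹) w|)) with hFE
  set FM : Config (N + 1) (Fin 3) T3 → ℝ≥0∞ := fun w => ENNReal.ofReal (Real.exp (3 * (p - 1) *
    |momentumObservable (fun x => (θ₀ x)⁻¹ • u₀ x) ((Φ N).flow s w) -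
      momentumObservable (fun x => (θ₀ x)⁻¹ • u₀ x) w|)) with hFM
  have hθi : Continuous fun x => (θ₀ x)⁻¹ := hθ.inv₀ fun x => (hθ0 x).ne'
  have habs : Measurable fun x : ℝ => |x| := continuous_abs.measurable
  have hFEm : Measurable FE := by
    have hc : Measurable (energyObservable (d := Fin 3) (N := N + 1) (X := T3) fun x => (θ₀ x)⁻¹) :=
      (continuous_energyObservable hθi).measurable
    exact (measurable_const.mul (habs.comp ((hc.comp ((Φ N).measurable_flow s)).sub hc))).exp.ennreal_ofReal
  have hFMm : Measurable FM := by
    have hc : Measurable (momentumObservable (d := Fin 3) (N := N + 1) (X := T3) fun x => (θ₀ x)⁻¹ • u₀ x) :=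
      (continuous_momentumObservable (hθi.smul hu)).measurable
    exact (measurable_const.mul (habs.comp ((hc.comp ((Φ N).measurable_flow s)).sub hc))).exp.ennreal_ofReal
  -- pointwise: `exp((p−1)(S w − S(Φ_s w))) ≤ FL/3 + FE/3 + FM/3`
  have hpt : ∀ w, ENNReal.ofReal (Real.exp ((p - 1) * (logW a θ₀ u₀ w - logW a θ₀ u₀ ((Φ N).flow s w)))) ≤
      FL w / 3 + FE w / 3 + FM w / 3 := by
    intro w
    set dL := ∑ i, ell a θ₀ u₀ ((Φ N).flow s w i).1 - ∑ i, ell a θ₀ u₀ (w i).1 with hdL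
    set dE := energyObservable (fun x => (θ₀ x)⁻¹) ((Φ N).flow s w) - energyObservable (fun x => (θ₀ x)⁻¹) w
      with hdE
    set dM := momentumObservable (fun x => (θ₀ x)⁻¹ • u₀ x) ((Φ N).flow s w) -
      momentumObservable (fun x => (θ₀ x)⁻¹ • u₀ x) w with hdM
    refine le_trans ?_ (ofReal_exp_mul_add_add_le (p - 1) |dL| |dE| |dM|)
    refine ENNReal.ofReal_le_ofReal (Real.exp_le_exp.2 (mul_le_mul_of_nonneg_left ?_ hp1.le))
    have e : logW a θ₀ u₀ w - logW a θ₀ u₀ ((Φ N).flow s w) = -dL + dE - dM := by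
      simp only [hdL, hdE, hdM, logW]
      ring
    rw [e]
    linarith [neg_le_abs dL, le_abs_self dE, neg_le_abs dM]
  have h3i : (3 : ℝ≥0∞)⁻¹ ≠ ∞ := ENNReal.inv_ne_top.2 three_ne_zero
  calc ∫⁻ w, ENNReal.ofReal (Real.exp ((p - 1) * (logW a θ₀ u₀ w - logW a θ₀ u₀ ((Φ N).flow s w)))) ∂P
      ≤ ∫⁻ w, (FL w / 3 + FE w / 3 + FM w / 3) ∂P := lintegral_mono hpt
    _ = (∫⁻ w, FL w ∂P) / 3 + (∫⁻ w, FE w ∂P) / 3 + (∫⁻ w, FM w ∂P) / 3 := by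
        rw [lintegral_add_right _ (hFMm.div_const 3), lintegral_add_right _ (hFEm.div_const 3)]
        simp only [div_eq_mul_inv]
        rw [lintegral_mul_const' _ _ h3i, lintegral_mul_const' _ _ h3i, lintegral_mul_const' _ _ h3i]
    _ ≤ E₁ / 3 + E₁ / 3 + E₁ / 3 :=
        add_le_add (add_le_add (ENNReal.div_le_div_right h3 3) (ENNReal.div_le_div_right h1 3))
          (ENNReal.div_le_div_right h2 3)
    _ = E₁ := ENNReal.add_thirds E₁

end Summit.AtomisticToContinuum.HydrodynamicLimit.Theorems.KineticWindowGronwallWindowRenyiOfIncrementTightness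

end
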